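import Mathlib
import HarnessLib
import HarnessLib.Audit
import Summits.RiemannHypothesis.Statement
import Literature.NumberTheory.LFunctions.WeilExplicit

/-!
Route: WeilComb

CLOSED (superseded) 2026-08-16T21:36:05Z by planner-rchoice-RiemannHypothesis-WeilComb-rq--e4fd20fe-0 — reason: superseded:route-RiemannHypothesis-WeilPos — superseded by route-RiemannHypothesis-WeilPos — note: route-choice retire-after-banking (planner-rchoice-RiemannHypothesis-WeilComb-rq--e4fd20fe-0), human ruling 2026-08-16 16.2x CDT (judged X — the deciding stub is RH-equivalent): RETIRED as superseded AFTER verifying all three required results are gate-accepted (axioms propext/Classical.choice/Quot.s. The file is kept as the record of this route; refuted decls are indexed as negative knowledge (`ledger negatives`).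

# Route WeilComb — Weil positivity on log-integer combs: the von Mangoldt Helson matrix never
outgrows the logarithm of its own size

It suffices to show X = uniform Weil positivity, `∀ a > 0, WeilPositivityOn a` (target CombThesis,
item shared with route WeilPos), and this route reaches X through ONE fixed arithmetic basis:
log-integer combs g = Σ_{m≤M} a_m φ_ε(· − log m), φ_ε = ε⁻¹φ₀(·/ε), with the FIXED bump φ₀(u) =
exp(−1/(1−u²)) on (−1,1) (Mathlib `expNegInvGlue (1 - u^2)`). REPAIR (2026-08-15, crux floor): the
shape is now fixed, because with φ free the M = 1 rung is every Weil test and comb positivity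
restated the target verbatim (retriage 10:53Z); with φ₀ fixed the M = 1 rung is one explicit
function of ε, and the RH content is a statement about a countable family of explicit finite
Hermitian matrices: since g ⋆ g̃ = Σ_{m,m′} a_m ā_{m′} τ_{log(m/m′)} ψ_ε (ψ_ε = φ_ε ⋆ φ_ε), W(g ⋆
g̃) = Σ a_m ā_{m′} w_ε(log(m/m′)) with w_ε(t) := W(τ_t ψ_ε) computable from prime powers, the
digamma kernel and the pole alone. For 2ε(M+1) ≤ 1 the prime part of this matrix is EXACTLY
‖φ_ε‖²·S_M, S_M = T + Tᵗ, (Ta)_m = Σ_{nm≤M} Λ(n) n^{−1/2} a_{nm} the von Mangoldt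
multiplicative-Toeplitz (Helson) matrix (supp ψ_ε = [−2ε, 2ε] and |log(m/(nm′))| > 1/(M+1) unless m
= nm′), the archimedean part is −((∫φ₀)²/2)·B_M(1+o(1)), B_M = (1/|log(m/m′)|)_{m≠m′}, and the
diagonal is ‖φ_ε‖²(log(1/ε) + c_φ₀): comb positivity reads λ_max(S_M + ε r B_M) ≤ log(1/ε) + c_φ₀ up
to the rank-2 pole, whose unconditional half λ_max(S_M) ≤ log M + C₀ is a two-line Collatz–Wielandt
estimate (CombHelsonBound, proved), whose subcritical regime ε·M ≤ c₀ is the unconditional Theorem A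
(CombSubcritical — PROVED in tree 2026-08-16, `WeilCombSubcritical.CombSubcritical_of`, universal
inexplicit c₀ ≤ 1/8), and whose full exact window 2ε(M+1) ≤ 1 — where the pole becomes load-bearing
and all three explicit-formula terms must be kept with their signs and constants — is Theorem B, the
line's next unconditional milestone (filed 2026-08-16 as crux CombExactWindow =
stmt-RiemannHypothesis-14683, refuter-vetted, and DROPPED from the route the same day under the
closes-cone rule: a rung feeds no hypothesis of `closes`, and every complement regime is co-final,
i.e. CombShapePositivity in costume, so Theorem B is pursued as a stub inside CombShapePositivity's
crux chain, not as a route item; see NOT DECOMPOSED YET). X splits as: CombShapePositivity (crux 2,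
RH-strength, all ε, M) → X by CombShapeDetection (support, provable: translation-invariance of g ⋆
g̃, log⌊N eˣ⌋ − log N → x, C¹-continuity of W, mollification), and X → RH is Weil's criterion
(Assembly, proved in tree as `weil_criterion_holds` + `uniformWeilPositivity_iff_weilPositivity`).
Lean: `∀ a : ℝ, 0 < a → Literature.NumberTheory.LFunctions.WeilPositivityOn a`

## Assembly
Pure logic (glue.lean, sorry-free, certified natively): `closes (hPos : CombShapePositivity) (hDet :
CombShapeDetection) (hA : Assembly) : Summit.RiemannHypothesis := hA (hDet hPos)`. Assembly is
Weil's criterion in the direction positivity ⇒ RH, uniform form; PROVED in tree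
(`riemannHypothesis_iff_forall_weilPositivityOn` = yoshida_criterion weil_criterion_holds), so the
item is dischargeable today. CombSubcritical (Theorem A, proved), CombHelsonBound, CombConverse,
CombShapeAdmissible and the target CombThesis are not hypotheses of `closes`: Theorem A is the
proved unconditional rung of the line (Theorem B, the exact-Helson window 2ε(M+1) ≤ 1, is parked
outside the route: NOT DECOMPOSED YET), the others are calibration.

Rationale: WHY THIS LINE. The comb basis turns "positivity of an abstract form on all test functions" into the
numerical range of two NAMED arithmetic matrices — the von Mangoldt Helson matrix S_M (prime side;
Perron–Frobenius/Collatz–Wielandt and multiplicative-Toeplitz/GCD-sum theory: Hilberdink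
doi:10.4064/aa125-3-4, Bondarenko–Seip arXiv:1507.05840, Nikolski–Pushnitski arXiv:2001.01474) and
the logarithmic Hilbert matrix B_M (archimedean side; Montgomery–Vaughan doi:10.1112/jlms/s2-8.1.73,
in tree HilbertInequality*.lean) — and splits the content cleanly: for ε·M ≤ c₀ positivity is an
unconditional, zeros-free theorem about primes on a cone of tests of UNBOUNDED support (S_M is
entrywise ≥ 0 with Perron vector m^{−1/2}, λ_max(S_M) = log M − 0.55…−0.564 numerically for M =
10³…10⁶, conjecturally log M − γ), while the RH-bearing regime is exactly the Montgomery–Vaughan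
transition T = 1/ε ~ M, where on the extremal direction a_m = m^{−1/2} (A = ζ_M) RH predicts W ~
0.046·M(∫φ₀)², barely positive by the Báez-Duarte–Burnol constant Σ1/|ρ|² = 2 + γ − log 4π
(arXiv:math/0103058). Fixing the shape φ₀ costs nothing in strength — RH ⟺ CombShapePositivity,
because Q(g) = W(g ⋆ g̃) is translation-invariant, {log m − log N} approximates every finite real
configuration, and W is continuous in C¹ on fixed compact support (Bombieri2000 §4; tree:
weilQuadratic_re_ge_of_tsupport_subset) — but it removes the M = 1 degeneracy and makes every finite
(ε, M) instance a zeros-free certificate: RH ⟺ all matrices [w_ε(log(m/m′))]_{m,m′≤M} are positive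
semidefinite. Distinct from route WeilPos (rungs by SUPPORT of g; prolate/Sonin/semi-local tools):
combs have unbounded support and a Dirichlet-coefficient basis and import a different community's
toolbox; the two routes share only the target X and the proved Assembly. The deciding chain is
already certified end to end: CombShapePositivity → X is the TWO-NODE case of the in-tree converse
of Weil's criterion (WeilCriterionConverse.lean proves positivity ⇒ RH using only the tests g +
c·g(· − x); two-node fixed-shape combs are translates of exactly these with x ∈ log ℚ_{>0}, dense),
and X → RH is riemannHypothesis_iff_forall_weilPositivityOn (UniformWeilPositivityRH.lean). STATUS
2026-08-16 (expansion after a crux closed): Theorem A = CombSubcritical is PROVED in tree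
(`WeilCombSubcritical.CombSubcritical_of`: ground-state identity of the Λ-Helson form, multiscale
Poincaré inequality, transfer core ∀C ∃c₀ ≤ 1/8; exact prime identity for 8εM ≤ 1; polar/arch bounds
— line helson-dirichlet-slack), as are CombHelsonBound, CombConverse and Assembly; the one live crux
is CombShapePositivity (rank 2, RH-strength; crux chain active:
Cruxes/CombShapePositivity/Disproof.lean + six crux ideas, lead on the Bohr–Fejér line, PICKED.md).
Theorem B — positivity on the whole exact-Helson window 2ε(M+1) ≤ 1, the regime this thesis'
dictionary describes verbatim, recommended by the standing disprover (Disproof.lean §9: a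
bounded-window statement is 'where a matrix-side gain could be real', precision ladder N4b) and by
the ideators (tapered-perron-localisation 'Theorem B0', pole-shadow-pair-sign) — was filed as crux
CombExactWindow (rank 3, stmt-RiemannHypothesis-14683, 2026-08-16 05:48Z; crux-attack SURVIVES
06:12Z: elaborates verbatim, M ≤ 1 cells proved, boundary ε = 1/(2(M+1)) positive definite for all M
≤ 85 checked with flat margin ≈ 0.057‖φ_ε‖², pole load-bearing on the whole boundary) and DROPPED
from the route the same day (route-repair, unused crux): it feeds no hypothesis of `closes`, and no
honest glue exists — the window is downward-closed in M, so every complement regime is co-final and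
equivalent to CombShapePositivity itself (weilComb_combShapePositivity_iff_eventually;
translation-invariance of weilQuadratic and continuity of the finite Hermitian form remove side
conditions on a), i.e. any item `CombExactWindow ∧ V → CombShapePositivity` would be the crux in
costume (the split already withdrawn in TWO-LAYER PLAN and in PICKED.md). The statement, its vetting
and its numerics stay on the moot ledger item stmt-RiemannHypothesis-14683 and in Disproof.lean;
Theorem B is now the recommended first delegated stub of any line on CombShapePositivity (NOT
DECOMPOSED YET). Negatives index (2026-08-16): empty.

RANKED CRUXES. #0 CombThesis (target) — uniform Weil positivity — for every a > 0 and every smooth g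
supported in [−a, a], Re W(g ⋆ g̃) ≥ 0; this is thesis X of route WeilPos (shared item): Weil's
quadratic functional weilQuadratic g = W(g ⋆ g̃) has non-negative real part for every smooth
compactly supported g : ℝ → ℂ (additive normalisation of Literature WeilExplicit). Equivalent to RH
by Weil's criterion [Weil1952; Bombieri2000 Thm 1; Yoshida1992]. Equals ∀ a > 0, WeilPositivityOn a
(uniformWeilPositivity_iff_weilPositivity, proved in Literature). (why it might fail: X ↔ RH
(weil_criterion_holds; Bombieri2000 Thm 2): false iff an off-line zero exists; no margin
(NewmanConjecture), inf QW_λ ~ e^{−cλ²} (arXiv:2106.01715 §2.5).)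
[Literature.NumberTheory.LFunctions.weil_criterion_holds,
Literature.NumberTheory.LFunctions.uniformWeilPositivity_iff_riemannHypothesis, Bombieri2000,
arXiv:2106.01715, Literature.Barriers.RiemannHypothesis.NewmanConjecture]
#2 CombShapePositivity (crux) — FIXED-SHAPE COMB POSITIVITY: for every ε > 0, every M and every a :
ℕ → ℂ, the comb g(x) = Σ_{m=1}^{M} a_m ε⁻¹φ₀((x − log m)/ε), φ₀(u) = exp(−1/(1−u²))·1_{|u|<1}, has
Re W(g ⋆ g̃) ≥ 0; equivalently every Hermitian matrix [w_ε(log(m/m′))]_{m,m′≤M}, w_ε(t) = W(τ_t(φ_ε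
⋆ φ_ε)), is positive semidefinite. RH-implied (each comb is a Weil test); by CombSubcritical its
content sits at ε·M ≳ c₀, the T ~ N transition: a SIGNED large-sieve-type inequality with constant
exactly 1, attacked by duality (bounds for Σ_ρ |Φ₀(ε(ρ−½))|²-weighted A(ρ)·conj A(1−ρ̄)) and by
classifying extremal vectors (m^{−1/2} profiles, GCD/Gál resonators, Möbius-twisted shapes). Card
weil-comb-cone-schur-threshold, Needs (6). [difficulty: open-problem] (why it might fail: False iff
RH fails: its 2×2 minors |w_ε(log q)| ≤ w_ε(0) (q ∈ ℚ_{>0}, all ε) already give RH by the in-tree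
WeilConverse argument, so no input short of RH-strength proves it; at ε·M ≍ 1 ζ_M-like vectors leave
slack ≈ 0.046·M against the scale M·log M (NewmanConjecture: no margin).)
[doi:10.1112/jlms/s2-8.1.73, Bombieri2000, arXiv:math/0103058, arXiv:1507.05840,
Literature.NumberTheory.LFunctions.WeilPositivity.of_riemannHypothesis,
card:RiemannHypothesis/RiemannHypothesis/weil-comb-cone-schur-threshold,
Literature.NumberTheory.LFunctions.WeilConverse.riemannHypothesis_of_zeroSide_nonneg]
#3 CombSubcritical (crux, CLOSED — PROVED 2026-08-16 by WeilCombSubcritical.CombSubcritical_of) —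
THEOREM A (unconditional): a universal c₀ > 0 such that every comb with ε·M ≤ c₀ (φ any Weil test
supported in [−1,1]) has Re W(g⋆g̃) ≥ 0 — Weil positivity on a cone of tests of UNBOUNDED support,
zeros-free. Proof as landed (line helson-dirichlet-slack, nine stub files): ground-state identity
⟨S_M a,a⟩ = Σ‖a_m‖²(log m + ψ₁(M/m)) − D(a) with D the multiplicative Dirichlet energy along
prime-power edges in the Perron gauge n^{−1/2}; multiscale Poincaré Σ m log m‖a_m‖² ≤ 2M·D +
C·M‖a‖²; transfer core ∀C ∃c₀ ≤ 1/8: ⟨S_M a,a⟩ + (c₀/M)·archShadow(a) ≤ (log M + log(1/c₀) − C)‖a‖²;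
analytic reduction Re Q(g) ≥ ε⁻¹‖φ‖₂²[(log(1/ε) − C)‖a‖² − ⟨S_M a,a⟩ − ε·archShadow(a)] for 8εM ≤ 1
(prime term exact, polar ≥ −5‖φ‖₂²A₋A₊, sharp arch diagonal, |W_∞(τ_xψ_ε)| ≤ ‖φ‖₁²(1/|x| + 1)). The
card's why-it-might-fail (a GROWING 2c₀r·log M loss for separate bounds) was overcome exactly as
foreseen: S_M and the absolute log-Hilbert kernel have their large directions at opposite ends
(m^{−1/2} vs flat near M), coupled through D. [doi:10.1112/jlms/s2-8.1.73, doi:10.4064/aa125-3-4,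
arXiv:1611.03772, Literature.NumberTheory.LFunctions.explicit_formula_holds,
Summits/RiemannHypothesis/RiemannHypothesis/Theorems/WeilCombCombSubcritical.lean]
#9 CombShapeDetection (support) — DETECTION (load-bearing, provable now): fixed-shape comb
positivity ⇒ uniform Weil positivity. Path A (in tree, two nodes suffice): a two-node comb is the
translate by log m of WeilConverse.translateMix φ_ε c (log(m′/m)); weilQuadratic is
translation-invariant; explicit_formula_holds + hasWeilZeroSide_zeroForm give 0 ≤ Re zeroForm on x ∈
log ℚ_{>0}; polarised norm_expSum_le bounds ‖expSum φ_ε x‖ on that dense set, hence on ℝ by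
continuity; BoundedPowerSum.sum_fiber_eq_zero_of_exp_real kills off-line exponents; for a zero of
ordinate γ take ε = 1/(1+|γ|) so Re φ̂_ε(σ + iγ) > 0, giving RH, then X by
riemannHypothesis_iff_forall_weilPositivityOn. Path B: translation-invariance + log⌊N eˣ⌋ − log N →
x + C¹-continuity of W + mollification. Evidence DETECTION.md. [difficulty: M] [Bombieri2000,
Literature.NumberTheory.LFunctions.WeilConverse.riemannHypothesis_of_zeroSide_nonneg,
Literature.NumberTheory.LFunctions.WeilConverse.norm_expSum_le,
Literature.Analysis.Complex.BoundedPowerSum.sum_fiber_eq_zero_of_exp_real,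
Literature.NumberTheory.LFunctions.weilMellin_weilTranslate,
Literature.NumberTheory.LFunctions.riemannHypothesis_iff_forall_weilPositivityOn]
#9 CombShapeAdmissible (support) — the fixed bump u ↦ exp(−1/(1−u²))·1_{|u|<1} (= expNegInvGlue (1 −
u²), coerced to ℂ) is a Weil test with tsupport ⊆ [−1, 1]; makes CombSubcritical and CombConverse
apply to the fixed-shape combs (so RH ⇒ CombShapePositivity, and Theorem A ⇒ its subcritical
regime). [difficulty: provable-now] [Mathlib:expNegInvGlue.contDiff,
Mathlib:expNegInvGlue.zero_of_nonpos, Literature.NumberTheory.LFunctions.IsWeilTest]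
#9 CombHelsonBound (support) — HELSON BOUND (support, provable now, two lines): for the von Mangoldt
multiplicative-Toeplitz form, 2Re⟨Ta,a⟩ = ⟨S_M a,a⟩ ≤ (log M + 1)‖a‖² where (Ta)_m = Σ_{n≤M/m}
Λ(n)n^{−1/2}a_{nm}, S_M = T + Tᵗ entrywise ≥ 0. Collatz–Wielandt with the positive Perron weight w_m
= m^{−1/2}: (S w)_m/w_m = Σ_{n≤M/m}Λ(n)/n + Σ_{d|m}Λ(d) = Σ_{n≤M/m}Λ(n)/n + log m ≤ log(M/m) + C₀ +
log m, with C₀ := sup_{y≥1}(Σ_{n≤y}Λ(n)/n − log y) ≤ 1 (Rosser–Schoenfeld 1962 (3.21)–(3.24) + prime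
powers; numerically C₀ = 0 attained at y = 1; Mertens: → −γ). Card numerics: λ_max(S_M) = log M −
0.550…−0.564 (M = 10³…10⁶), top vector ≈ m^{−1/2}; conjecture log M − γ + o(1). Context:
multiplicative Toeplitz operators (Hilberdink doi:10.4064/aa125-3-4; Nikolski–Pushnitski
arXiv:2001.01474). [difficulty: provable-now] [RosserSchoenfeld1962 (3.21)–(3.24),
doi:10.4064/aa125-3-4, arXiv:2001.01474, Mathlib ArithmeticFunction.vonMangoldt_sum (Σ_{d|m}Λ(d) =
log m)]
#9 CombConverse (support) — CALIBRATION (support, provable now): RH → comb positivity, immediate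
from WeilPositivity.of_riemannHypothesis explicit_formula_holds (combs are Weil tests: finite sums
of dilated translates of a smooth compactly supported φ are ContDiff with compact support). Shows #2
is not stronger than RH. [difficulty: provable-now]
[Literature.NumberTheory.LFunctions.WeilPositivity.of_riemannHypothesis,
Literature.NumberTheory.LFunctions.explicit_formula_holds]

TWO-LAYER PLAN. Windows NEST, they do not split: by zero-extension of the coefficients
(weilComb_combShapePositivity_iff_eventually, landed Negative file) every co-final instance family —
in particular 'εM ≥ c₀, the transition and beyond' — is equivalent to the whole of
CombShapePositivity, so the formerly foreseen case split Subcritical → Transition →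
CombShapePositivity is withdrawn as a costume; the rungs Theorem A (εM ≤ c₀, proved) ⊂ Theorem B
(2ε(M+1) ≤ 1; parked, not an item) ⊂ unit window εM ≤ 1 ⊂ … ⊂ CombShapePositivity (C → ∞ = RH,
precision f(C) ≈ e^{−5.3√C}, Disproof N1/N4b) are separate statements; under the closes-cone rule
(2026-08-16) such a rung is NOT a route item (it feeds no hypothesis of `closes`) but a milestone
pursued as stubs inside CombShapePositivity's crux chain, re-attachable as an item only as the
`--glue-by` child of a PROVED theorem connecting it to CombShapePositivity. Foreseen decomposition
of Theorem B (as stubs of such a line, k ≤ 3): ExactWindowIdentity (finite-dimensional exact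
bookkeeping K_{ε,M} = P − ‖φ_ε‖²S_M + A on the window, pole kept) → PerronConeCoercivity
(near-minimisers are tapered Perron rays: Q ≥ ψ_ε(0)[D(a)/2 − Δ(a) − C‖a‖²], D = multiplicative
Dirichlet energy of line helson-dirichlet-slack) → SoftConeBookkeeping (on that cone the O(1)
constants −log(εM) + c_φ₀ + γ + pole − arch beam − near hits are ≥ 0 down to 2ε(M+1) = 1, explicit
Mertens constants + certified finite computation) → Theorem B. CombShapePositivity itself is
decomposed only through its crux chain (lines with registered stubs), never by instance regime.

KILL CRITERIA. (i) A certified comb (fixed shape, any ε, M, a) with W(g ⋆ g̃) < 0 refutes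
CombShapePositivity AND RH — a zeros-free ¬RH certificate format (one negative eigenvalue of an
explicit M×M matrix; refuters probe ε·M ∈ [1,5]); the route then closes
`refuted:CombShapePositivity` having decided the summit negatively. (ii) CombSubcritical refuted for
every universal c₀ (c₀ must shrink with M) guts the unconditional half — restate with c₀(φ, M) only
if c₀ ≫ 1/log M, else close as superseded by WeilPos ('no subcritical theorem, no matrix-side
gain'). (iii) CombShapeDetection is a lemma with an in-tree proof path (two-node combs +
WeilCriterionConverse; evidence DETECTION.md on stmt-RiemannHypothesis-11230); only if BOTH that
path and the density/mollification path fail formally is the cone enlarged by finitely many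
shapes/translates (not a kill). (iv) Close as superseded by WeilPos if refuters show
CombShapePositivity at the transition is verbatim WeilPositivityOn(a) rung by rung with no
matrix-side gain. (v) Theorem B (parked milestone, not an item): a certified negative eigenvalue in
a cell with 2ε(M+1) ≤ 1 refutes RH (as (i)); methodologically, if the fragility threshold q*(εM =
1/2) keeps growing with M instead of saturating near 4·10² (kit j008240 brackets it at M = 800), or
the 1.4·10⁻² precision proves unreachable from explicit PNT constants plus finite computation, lines
on CombShapePositivity aim their unconditional stub at the largest window the zeros-free bookkeeping
provably reaches (an explicit c₀ from Theorem A's chain) instead of the exact window.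

NOT DECOMPOSED YET. THEOREM B PARKED (2026-08-16): exact-window comb positivity — for every ε > 0,
M, a with 2ε(M+1) ≤ 1 the fixed-shape comb has Re W(g ⋆ g̃) ≥ 0, i.e. ⟨S_M a,a⟩ ≤ (log(1/ε) +
c_φ₀)‖a‖² + (signed archimedean form) + (rank-2 pole) exactly on the whole exact-Helson window — was
filed as crux CombExactWindow (stmt-RiemannHypothesis-14683, rank 3, refuter-vetted, difficulty XL)
and dropped as an unused crux: no item of this route carries it until a PROVED theorem connects it
to CombShapePositivity (then re-attach the moot item by its unchanged signature as a `--glue-by`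
split child); until then it is the recommended first delegated stub of lines on CombShapePositivity
(needs: γ-sharp Helson λ_max(S_M) = log M − γ + o(1), the signed logarithmic Hilbert form with the
Montgomery–Vaughan constant, the pole's positive coupling to the Perron ray, Mertens-type prime sums
to absolute precision ≈ 1.4·10⁻² uniformly in M, Ramaré-type explicit PNT doi:10.4064/aa159-2-2 plus
a certified finite computation; Theorem A covers εM ≤ c₀, the pole is load-bearing from εM ≈ 0.3,
Disproof N3; M ≤ 1 cells proved in the crux-attack file W.lean on stmt-RiemannHypothesis-14683). No
explicit-c₀ (effective) Theorem A item — extracting constants from the nine landed stubs is the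
natural first stub of any Theorem B line, not an item; no unit-window (εM ≤ 1, precision 2·10⁻³) or
C = 2 rung above Theorem B (same rule: rungs are stubs, not items); no sharp-Helson item λ_max(S_M)
= log M − γ + o(1) (now a foreseen stub of Theorem B, see Two-layer plan); no M = 2 cell item
|w_ε(log 2)| ≤ w_ε(0) for all ε (smallest open cell, margin ≥ 6.6 %, toolchain calibration only —
Disproof §9); no transition/regime split of CombShapePositivity (co-final ⇒ costume, above); no
two-node CombPairPositivity item (|w_ε(log q)| ≤ w_ε(0), q ∈ ℚ_{>0}, all ε: RH in classical clothing
— proof device inside CombShapeDetection); no lacunary/tower items (geometric towers b^j, S-unit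
ladders 2^i3^j: these are crux IDEAS on CombShapePositivity — frobenius-tower-toeplitz,
s-unit-comb-toeplitz-ladder, bohr-fejer-reduction, levinson-through-primes — and become lines with
stubs there, not route items); no Li/Keiper face, no link item to NymanBeurling's d_N².

CHEAPEST FALSIFIER. Done since open: the exact Gram matrices K_{ε,M} = [w_ε(log(m/m′))] (tree
normalisation, validated against the zero side to 1e-13) are ALL positive definite for M ≤ 200 (kit
j007995 extends to M ≤ 800), εM ≤ 20 (Disproof N1) — as they must be where RH is verified; the card
model's '−0.8 at εM = 1' was an artefact of dropping pole/smoothing terms (cf. Groskin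
arXiv:2607.02828 Cor. 3.3). Cheapest remaining checks: for the LINE, a certified negative eigenvalue
at any (ε, M) is a ¬RH certificate (cannot fire at accessible heights); for THEOREM B's feasibility,
the fragility bracket of kit j008240 at M = 800, εM = 1/2 — saturation of q* near 4·10² (threshold
law δλ_min ≈ −κ(log q/q)h‖φ_ε‖², κ ≈ 4) keeps the finite-computation-plus-explicit-Mertens strategy
alive, growth q* ∝ M kills it (Kill (v)); for THEOREM B's statement at small size, interval-certify
λ_min(K_{ε,M}) > 0 on the grid M ≤ 60, 2ε(M+1) = 1 (margins 0.05–1.6 ‖φ_ε‖², far above quadrature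
error).

NUMBERS. λ_max(S_M) = log M − 0.550, −0.554, −0.557, −0.559, −0.561, −0.5625, −0.564 for M = 10³…10⁶
(card numerics; conjecture log M − γ); C₀ = sup_y(Σ_{n≤y}Λ(n)/n − log y) ≤ 1 (RosserSchoenfeld1962
(3.21)–(3.24)); ‖B_M‖ ~ 2M log M on flat vectors near M, Rayleigh quotient ~ 2M at m^{−1/2}; RH
calibration at the transition W ~ 0.046·M(∫φ₀)² from Σ_ρ 1/|ρ|² = 2 + γ − log 4π ≈ 0.0462
(arXiv:math/0103058); proved rung: WeilPositivityOn a for a ≤ (log 2)/2 ≈ 0.3466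
(weilPositivityOn_of_le_log_two_half) = the M = 1, ε ≤ 0.3466 instances of CombShapePositivity;
mean-value heuristic for detectors: a resonator of length M sees an off-line zero at height γ₀ only
if ε·M ≳ log γ₀ (γ₀ > 3·10¹², PlattTrudgian2021), which is why the shape, not the window ε·M, is
what the repair fixes. Two-node face: w_ε(x) = W(τ_x ψ_ε) for x > 2ε is 2cosh(x/2)·ψ̂-mass (polar) −
Σ_{|log n−x|<2ε} Λ(n)n^{−1/2}ψ_ε(log n − x) (prime) − ∫₀^∞ e^{t/2}ψ_ε(t−x)/(2 sinh t) dt (arch, ≈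
−(∫φ₀)²/(2x) for small x = the B_M entry), against w_ε(0) ≈ ‖φ_ε‖²(log(1/ε) + c_φ₀) ≍ ε⁻¹ log(1/ε);
the two-node detection argument uses ε(1+|γ₀|) ≤ 1 (so cos(γ₀t) > 0 on supp φ_ε) and unbounded x =
log(m′/m), i.e. ε·M unbounded — it says nothing about bounded windows ε·M ≤ C₁, where
(heuristically, Landau–Gonek) the on-line mass (T/2π)[(log T)‖a‖² − ⟨S_M a,a⟩] stays positive
exactly in the subcritical regime. Exact-matrix margins (Disproof N1, M ≤ 200):
λ_min(K_{ε,M})/‖φ_ε‖² = 1.65, 0.50, 0.054, 8.5e-3, 5.7e-4, 8e-6 at εM = 0.05, 0.2, 0.5, 1, 2, 5 (a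
function of εM to ±15 %, slowly increasing in M; ln margin ≈ −4.8 − 5.3(√(εM) − 1) for εM ≥ 1);
load-bearing map (N3, M = 100–200): no-polar margin +1.50 / −1.64 / −3.74 at εM = 0.05 / 0.5 / 1
(pole load-bearing from εM ≈ 0.3), P + A alone indefinite from εM ≈ 1; fragility (N4): one fake
prime at q flips the sign iff κ(log q/q)h ≳ f(εM), saturated thresholds q* ≈ 4·10² (εM = 0.5), 4·10³
(1), 10⁵ (2); precision ladder (N4b): 1.4·10⁻² (C = 0.5), 2·10⁻³ (1), 1.4·10⁻⁴ (2); bottom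
eigenvector overlap with m^{−1/2}: 0.9996 … 0.988 (N2). Items: 8 (2 of kind crux:
CombShapePositivity r2 open, CombSubcritical r3 proved; 1 target; 1 assembly (proved); 4 support, of
which CombHelsonBound and CombConverse proved); CombExactWindow (Theorem B, r3; added by planner
rchoice 2026-08-16 05:48Z with Sketch.lean rc 0, crux-attack survives 06:12Z) dropped 2026-08-16 by
route-repair as an unused crux (closes unchanged: hA (hDet hPos)).

DEFINITION REQUESTS. None: weilQuadratic, IsWeilTest, WeilPositivityOn
(Literature.NumberTheory.LFunctions.WeilExplicit), expNegInvGlue and ArithmeticFunction.vonMangoldt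
(Mathlib) exist; the fixed bump is written inline.

Novelty: Searches (2026-08-15, card + route open + this repair): lit search --source zbmath "multiplicative
Toeplitz" (15 rows: Nikolski–Pushnitski doi:10.1090/spmj/1683 = arXiv:2001.01474; Hilberdink
doi:10.4064/aa125-3-4; Nikolski doi:10.1007/978-3-030-74417-5_21), "multiplicative Toeplitz matrix
largest eigenvalue" (0), "Weil explicit formula quadratic form Dirichlet polynomial von Mangoldt
matrix largest eigenvalue" (0); lit galaxy search --star all "multiplicative Toeplitz matri"
(Hilberdink, determinants); lit frontier RiemannHypothesis --since 2023 (Connes arXiv:2602.04022,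
CCM arXiv:2601.12133: Galerkin/operator truncations, not coefficient combs); the card's zbMATH "Weil
positivity" scan (25 rows); five refuter novelty audits (latest 16:10Z: kept new-combination,
'thin'); this repair seat: lit search --source zbmath "Weil positivity" --year-from 2015 (25 rows:
Connes–Consani arXiv:2006.13771 and arXiv:1910.14368, CCM arXiv:2310.18423, Groskin arXiv:2607.02828
/ arXiv:2605.20224, Suzuki arXiv:2206.03682, X.-J. Li arXiv:2404.13427 (Hilbert–Schmidt operator for
the Weil distribution), Broughan doi:10.1017/9781108178266 — none tests the Weil form on log-integer
combs or states a discrete-node PSD criterion), --source zbmath "Weil quadratic functional" (20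
rows: Bombieri 2000 zbl:1008.11034 only relevant), --source zbmath "Weil explicit formula quadratic
form Dirichlet polynomial test functions positivity" (0), --source zbmath "positive definite
functions on the set of logarithms  [refs: 10.1090/spmj/1683, 10.4064/aa125-3-4, 10.1007/978-3-030-74417-5_21, 10.1017/9781108178266, 10.1002/cpa.10089, 10.4064/aa139-4-3, 10.1112/jlms/s2-8.1.73, 2001.01474, 2602.04022, 2601.12133, 2006.13771, 1910.14368, 2310.18423, 2607.02828, 2605.20224, 2206.03682, 2404.13427, 2511.23257, 2511.22755, 1411.7294, 1507.05840, doi:10.1090/spmj/1683, doi:10.4064/aa125-3-4, doi:10.1007/978-3-030-74417-5_21, ]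

Barriers (technique_class: Weil-positivity Helson-matrix Hilbert-inequality combs): - technique_class: Weil-positivity Helson-matrix Hilbert-inequality combs
- Literature.Barriers.RiemannHypothesis.DeBrangesPositivity: respected, not engaged — positivity is
claimed only for the exact Weil form with polar terms included (the comb identity is the explicit
formula verbatim, explicit_formula_holds), which is RH-implied
(WeilPositivity.of_riemannHypothesis); de Branges' stronger axioms are never used.
- Literature.Barriers.RiemannHypothesis.NewmanConjecture: consistent — no margin at the target: the
predicted transition value 0.046·M(∫φ₀)² against the natural scale M log M is the comb face of
'barely true'; CombShapePositivity must therefore be an identity-level/structural inequality, not a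
perturbative estimate (declared in its why-it-might-fail).
- Literature.Barriers.RiemannHypothesis.MollifierLimitations: not in class — nothing mollifies ζ;
the Dirichlet polynomial is the TEST and lengths are compared with heights (large-sieve transition T
~ N), not Levinson's θ.
- Literature.Barriers.RiemannHypothesis.NymanBeurlingObstructions: different quadratic form; flagged
because the extremal direction is again ζ_M and Σ1/|ρ|² reappears in the RH calibration — a bridge
to route NymanBeurling's d_N², not an obstruction to the cruxes.
- Literature.Barriers.RiemannHypothesis.DavenportHeilbronn: evaded in kind — Λ(n) ≥ 0 supported on
prime powers is used essentially (entrywise non-negative S_M, Perron weight m^{−1/2}, exact Helson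
structure); for the DH function the 'prime

History (route lifecycle, newest last):
- 2026-08-15T16:55:20Z · rev 3: dropped CombPositivity, CombDetection — route-repair (rbadge-…-9048c157-g2, 2026-08-15): crux floor + deciding theorem + cone. FIXED-SHAPE restatement per retriage 10:53Z: add CombShapePositivity (cru (planner-rbadge-RiemannHypothesis-WeilComb-9048c157-g2-0)
- 2026-08-16T06:25:06Z · rev 8: dropped CombExactWindow — route-repair unused-crux (rrepair-…-unu-16060bef, 2026-08-16): DROP CombExactWindow (Theorem B, stmt-RiemannHypothesis-14683, crux r3 added 05:48Z by rchoice, c (planner-rrepair-RiemannHypothesis-WeilComb-unu-16060bef-0)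
- 2026-08-16T16:38:40Z · skeleton.hides-summit: stub_fejer (stmt-RiemannHypothesis-11229) ⟷ summit (accepted p111644 (siege k4, 15:26Z): Fejér-kernel positivity ↔ RiemannHypothesis; coordinator seed) (operator:999:1780479)
- 2026-08-16T16:59:49Z · skeleton.hides-summit: combShapePositivity_iff_fejerDivisorPositivity (stmt-RiemannHypothesis-11229) ⟷ summit (accepted theorem in Summits/RiemannHypothesis/RiemannHypothesis/Theorems/FejerDivisorPositivity.lean) (prover-line-stmt-RiemannHypothesis-11229-c3-0)
- 2026-08-16T21:36:05Z · CLOSED superseded — superseded:route-RiemannHypothesis-WeilPos (planner-rchoice-RiemannHypothesis-WeilComb-rq--e4fd20fe-0)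

sub-problem: RiemannHypothesis · status: closed(superseded) · opened planner-plancards-RiemannHypothesis-RiemannHypothesis-20260815w1-2-0 2026-08-15T10:39:42Z · rev 8 · ledger route-RiemannHypothesis-WeilComb
GENERATED by the gate from the ledger (D-0016/17). Provers cite these decls: `theorem foo : Summit.RiemannHypothesis.RiemannHypothesis.Theses.WeilComb.<Decl> := …` in Summits/RiemannHypothesis/RiemannHypothesis/Theorems/<Name>.lean.
-/

namespace Summit.RiemannHypothesis.RiemannHypothesis.Theses.WeilComb

open scoped BigOperators Topology Manifold Classical MeasureTheory ProbabilityTheory Matrix InnerProductSpace ComplexConjugate ContinuousMap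
open Filter Set Function TopologicalSpace MeasureTheory

attribute [summit_statement] _root_.Summit.RiemannHypothesis

open Summit

/-- item stmt-RiemannHypothesis-0098 · target · rank 0 · open · by planner
why it might fail: X ↔ RH (weil_criterion_holds; Bombieri2000 Thm 2): false iff an off-line zero exists; no margin (NewmanConjecture), inf QW_λ ~ e^{−cλ²} (arXiv:2106.01715 §2.5).
sources: Literature.NumberTheory.LFunctions.weil_criterion_holds, Literature.NumberTheory.LFunctions.uniformWeilPositivity_iff_riemannHypothesis, Bombieri2000, arXiv:2106.01715, Literature.Barriers.RiemannHypothesis.NewmanConjecture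
Thesis X of route WeilPos: Weil's quadratic functional weilQuadratic g = W(g ⋆ g̃) has non-negative
real part for every smooth compactly supported g : ℝ → ℂ (additive normalisation of Literature
WeilExplicit). Equivalent to RH by Weil's criterion [Weil1952; Bombieri2000 Thm 1; Yoshida1992].
Equals ∀ a > 0, WeilPositivityOn a (uniformWeilPositivity_iff_weilPositivity, proved in Literature). -/
@[route_item "route-RiemannHypothesis-WeilComb"]
def CombThesis : Prop :=
  ∀ a : ℝ, 0 < a → Literature.NumberTheory.LFunctions.WeilPositivityOn a

/-- item stmt-RiemannHypothesis-11229 · crux · rank 2 · closed · moot by None · by planner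
why it might fail: False iff RH fails: its 2×2 minors |w_ε(log q)| ≤ w_ε(0) (q ∈ ℚ_{>0}, all ε) already give RH by the in-tree WeilConverse argument, so no input short of RH-strength proves it; at ε·M ≍ 1 ζ_M-like vectors leave slack ≈ 0.046·M against the scale M·log M (NewmanConjecture: no margin).
sources: doi:10.1112/jlms/s2-8.1.73, Bombieri2000, arXiv:math/0103058, arXiv:1507.05840, Literature.NumberTheory.LFunctions.WeilPositivity.of_riemannHypothesis, card:RiemannHypothesis/RiemannHypothesis/weil-comb-cone-schur-threshold
[crux] FIXED-SHAPE COMB POSITIVITY: for every ε > 0, every M and every a : ℕ → ℂ, the comb g(x) =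
Σ_{m=1}^{M} a_m ε⁻¹φ₀((x − log m)/ε), φ₀(u) = exp(−1/(1−u²))·1_{|u|<1}, has Re W(g ⋆ g̃) ≥ 0;
equivalently every Hermitian matrix [w_ε(log(m/m′))]_{m,m′≤M}, w_ε(t) = W(τ_t(φ_ε ⋆ φ_ε)), is
positive semidefinite. RH-implied (each comb is a Weil test); by CombSubcritical its content sits at
ε·M ≳ c₀, the T ~ N transition: a SIGNED large-sieve-type inequality with constant exactly 1,
attacked by duality (bounds for Σ_ρ |Φ₀(ε(ρ−½))|²-weighted A(ρ)·conj A(1−ρ̄)) and by classifying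
extremal vectors (m^{−1/2} profiles, GCD/Gál resonators, Möbius-twisted shapes). Card
weil-comb-cone-schur-threshold, Needs (6). [difficulty: open-problem] -/
@[route_item "route-RiemannHypothesis-WeilComb"]
def CombShapePositivity : Prop :=
  ∀ ε : ℝ, 0 < ε → ∀ (M : ℕ) (a : ℕ → ℂ), 0 ≤ (Literature.NumberTheory.LFunctions.weilQuadratic (fun x : ℝ => ∑ m ∈ Finset.Icc 1 M, a m * ((ε : ℂ)⁻¹ * ((expNegInvGlue (1 - ((x - Real.log (m : ℝ)) / ε) ^ 2) : ℝ) : ℂ)))).re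

/-- item stmt-RiemannHypothesis-1025 · crux · rank 3 · closed · proved by Summit.RiemannHypothesis.RiemannHypothesis.Theorems.WeilCombSubcritical.CombSubcritical_of (prover) · by planner
why it might fail: Universal c₀ needs a JOINT bound ⟨S_M a,a⟩+εr⟨B_M a,a⟩ ≤ (log(1/ε)+O(1))‖a‖²: λ(S_M)≈log M−0.56 but εr‖B_M‖≈2c₀r·log M (flat a near M), so separate norm/Schur/MV bounds lose a GROWING 2c₀r·log M; cross terms, B_M-smoothing at |log(m/m′)|≍ε and the rank-2 pole must be O(1) in φ.
sources: doi:10.1112/jlms/s2-8.1.73, doi:10.4064/aa125-3-4, arXiv:1611.03772, Literature.NumberTheory.LFunctions.weilPositivityOn_of_le_log_two_half, Literature.NumberTheory.LFunctions.explicit_formula_holds, Literature/NumberTheory/LFunctions/HilbertInequality.lean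
THEOREM A (crux #3, unconditional target): there is a universal c₀ > 0 such that every comb with ε·M
≤ c₀ (φ supported in [−1,1]) has Re W(g⋆g̃) ≥ 0 — Weil positivity on a cone of tests of UNBOUNDED
support, proved without zeros. Ingredients: (1) exact comb identity for ε ≤ c/M (|log(m/m′) − log n|
≥ 1/(nm′) for m ≠ nm′; explicit_formula_holds); (2) CombHelsonBound λ_max(S_M) ≤ log M + C₀ (Perron
weight m^{−1/2}); (3) joint-form lemma sup_a[⟨S_M a,a⟩ + ε r⟨B_M a,a⟩]/‖a‖² ≤ log(1/ε) + c_φ for ε·M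
≤ c₀, r = (∫φ)²/(2‖φ‖²) ≤ 1 — B_M = (1/|log(m/m′)|) is the ABSOLUTE kernel (norm ~ 2M log M, flat
vectors near M; refuter audit), nearly orthogonal to S_M's top vector, so sup ≈ log M·max(1, 2rc₀) +
O(1); (4) pole term 2Re(ĝ(0)conj ĝ(1)): rank ≤ 2, indefinite, of size ≲ √2(∫φ)²M√(log M)‖a‖² on
mixtures of m^{∓1/2}, harmless because the 2×2 determinant condition reads s₀ ≥ 2c₀² with both sides
∝ log M (planner check); (5) c_φ = E_{|φ̂|²}log|u| − log 2π ≥ −C uniformly for supp φ ⊆ [−1,1]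
(uncertainty). Card numerics (M = 1200): slack +3.5, +2.0, +0.7, −0.8 at ε·M = 0.05, 0.2, 0.5, 1.0. -/
@[route_item "route-RiemannHypothesis-WeilComb"]
def CombSubcritical : Prop :=
  ∃ c₀ : ℝ, 0 < c₀ ∧ ∀ φ : ℝ → ℂ, Literature.NumberTheory.LFunctions.IsWeilTest φ → tsupport φ ⊆ Set.Icc (-1) 1 → ∀ ε : ℝ, 0 < ε → ∀ (M : ℕ) (a : ℕ → ℂ), ε * M ≤ c₀ → 0 ≤ (Literature.NumberTheory.LFunctions.weilQuadratic (fun x : ℝ => ∑ m ∈ Finset.Icc 1 M, a m * ((ε : ℂ)⁻¹ * φ ((x - Real.log (m : ℝ)) / ε)))).re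

/-- item stmt-RiemannHypothesis-1027 · support · rank 9 · closed · proved by Summit.RiemannHypothesis.RiemannHypothesis.Theorems.combHelsonBound_proof (prover) · by planner
sources: RosserSchoenfeld1962 (3.21)–(3.24), doi:10.4064/aa125-3-4, arXiv:2001.01474, Mathlib ArithmeticFunction.vonMangoldt_sum (Σ_{d|m}Λ(d) = log m)
HELSON BOUND (support, provable now, two lines): for the von Mangoldt multiplicative-Toeplitz form,
2Re⟨Ta,a⟩ = ⟨S_M a,a⟩ ≤ (log M + 1)‖a‖² where (Ta)_m = Σ_{n≤M/m} Λ(n)n^{−1/2}a_{nm}, S_M = T + Tᵗ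
entrywise ≥ 0. Collatz–Wielandt with the positive Perron weight w_m = m^{−1/2}: (S w)_m/w_m =
Σ_{n≤M/m}Λ(n)/n + Σ_{d|m}Λ(d) = Σ_{n≤M/m}Λ(n)/n + log m ≤ log(M/m) + C₀ + log m, with C₀ :=
sup_{y≥1}(Σ_{n≤y}Λ(n)/n − log y) ≤ 1 (Rosser–Schoenfeld 1962 (3.21)–(3.24) + prime powers;
numerically C₀ = 0 attained at y = 1; Mertens: → −γ). Card numerics: λ_max(S_M) = log M −
0.550…−0.564 (M = 10³…10⁶), top vector ≈ m^{−1/2}; conjecture log M − γ + o(1). Context: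
multiplicative Toeplitz operators (Hilberdink doi:10.4064/aa125-3-4; Nikolski–Pushnitski
arXiv:2001.01474). -/
@[route_item "route-RiemannHypothesis-WeilComb"]
def CombHelsonBound : Prop :=
  ∀ (M : ℕ) (a : ℕ → ℂ), 1 ≤ M → 2 * (∑ m ∈ Finset.Icc 1 M, ∑ n ∈ Finset.Icc 1 (M / m), ((ArithmeticFunction.vonMangoldt n : ℝ) : ℂ) / (Real.sqrt n : ℂ) * a (n * m) * conj (a m)).re ≤ (Real.log M + 1) * ∑ m ∈ Finset.Icc 1 M, ‖a m‖ ^ 2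

/-- item stmt-RiemannHypothesis-1028 · support · rank 9 · closed · proved by Summit.RiemannHypothesis.RiemannHypothesis.Theorems.combConverse_proof @ d99e6b8a9f30 (prover) · by planner
sources: Literature.NumberTheory.LFunctions.WeilPositivity.of_riemannHypothesis, Literature.NumberTheory.LFunctions.explicit_formula_holds
CALIBRATION (support, provable now): RH → comb positivity, immediate from
WeilPositivity.of_riemannHypothesis explicit_formula_holds (combs are Weil tests: finite sums of
dilated translates of a smooth compactly supported φ are ContDiff with compact support). Shows #2 is
not stronger than RH. -/
@[route_item "route-RiemannHypothesis-WeilComb"]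
def CombConverse : Prop :=
  Summit.RiemannHypothesis → (∀ φ : ℝ → ℂ, Literature.NumberTheory.LFunctions.IsWeilTest φ → tsupport φ ⊆ Set.Icc (-1) 1 → ∀ ε : ℝ, 0 < ε → ∀ (M : ℕ) (a : ℕ → ℂ), 0 ≤ (Literature.NumberTheory.LFunctions.weilQuadratic (fun x : ℝ => ∑ m ∈ Finset.Icc 1 M, a m * ((ε : ℂ)⁻¹ * φ ((x - Real.log (m : ℝ)) / ε)))).re)

/-- item stmt-RiemannHypothesis-11230 · support · rank 9 · closed · proved by Summit.RiemannHypothesis.RiemannHypothesis.Theorems.combShapeDetection_proof (prover) · by planner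
sources: Bombieri2000, Literature.NumberTheory.LFunctions.weilQuadratic_re_ge_of_tsupport_subset, Literature.NumberTheory.LFunctions.weilQuadratic_const_mul, Literature.NumberTheory.LFunctions.weilArchTermBombieri_eq_weilArchTerm, Mathlib:HasCompactSupport.contDiff_convolution_left, Literature.NumberTheory.LFunctions.WeilConverse.riemannHypothesis_of_zeroSide_nonneg
[support] DETECTION (provable now, load-bearing): fixed-shape comb positivity ⇒ uniform Weil
positivity. Proof: (i) Q(g) := W(g ⋆ g̃) is translation-invariant since (τ_s g) ⋆ (τ_s g)~ = g ⋆ g̃;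
(ii) for real nodes x₁,…,x_k ≥ 0 put m_i = ⌊N e^{x_i}⌋: log m_i − log N → x_i, so G = Σ c_i φ_ε(· −
x_i) is the C¹-limit on a fixed compact of translates of genuine combs, and W is continuous in C¹ on
fixed compact support (polar and prime terms bounded by sup|h|; the Bombieri arch integrand
(e^{t/2}(h(t)+h(−t)) − 2h(0))/(2 sinh t) by sup|h′| near 0), hence Re Q(G) ≥ 0; (iii) Riemann sums Σ
g(x_i)Δ·φ_ε(· − x_i) → g ⋆ φ_ε in C¹, so Re Q(g ⋆ φ_ε) ≥ 0 for every Weil test g; (iv) ε → 0: g ⋆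
φ_ε → (∫φ₀)·g in C^∞ on a fixed compact, ∫φ₀ > 0, so Re Q(g) ≥ 0. Replaces the dropped CombDetection
(trivial as signed) — the fixed shape is what makes this a lemma rather than a rescaling.
[difficulty: L] -/
@[route_item "route-RiemannHypothesis-WeilComb"]
def CombShapeDetection : Prop :=
  (∀ ε : ℝ, 0 < ε → ∀ (M : ℕ) (a : ℕ → ℂ), 0 ≤ (Literature.NumberTheory.LFunctions.weilQuadratic (fun x : ℝ => ∑ m ∈ Finset.Icc 1 M, a m * ((ε : ℂ)⁻¹ * ((expNegInvGlue (1 - ((x - Real.log (m : ℝ)) / ε) ^ 2) : ℝ) : ℂ)))).re) → ∀ a : ℝ, 0 < a → Literature.NumberTheory.LFunctions.WeilPositivityOn a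

/-- item stmt-RiemannHypothesis-11231 · support · rank 9 · closed · proved by Summit.RiemannHypothesis.RiemannHypothesis.Theorems.combShapeAdmissible_proof (prover) · by planner
sources: Mathlib:expNegInvGlue.contDiff, Mathlib:expNegInvGlue.zero_of_nonpos, Literature.NumberTheory.LFunctions.IsWeilTest
[support] the fixed bump u ↦ exp(−1/(1−u²))·1_{|u|<1} (= expNegInvGlue (1 − u²), coerced to ℂ) is a
Weil test with tsupport ⊆ [−1, 1]; makes CombSubcritical and CombConverse apply to the fixed-shape
combs (so RH ⇒ CombShapePositivity, and Theorem A ⇒ its subcritical regime). [difficulty: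
provable-now] -/
@[route_item "route-RiemannHypothesis-WeilComb"]
def CombShapeAdmissible : Prop :=
  Literature.NumberTheory.LFunctions.IsWeilTest (fun u : ℝ => ((expNegInvGlue (1 - u ^ 2) : ℝ) : ℂ)) ∧ tsupport (fun u : ℝ => ((expNegInvGlue (1 - u ^ 2) : ℝ) : ℂ)) ⊆ Set.Icc (-1) 1

/-- item stmt-RiemannHypothesis-0099 · assembly · rank 1 · closed · proved by Summit.RiemannHypothesis.RiemannHypothesis.Theorems.weilCombAssembly_proof @ a2447a268549 (prover) · by planner
sources: Literature.NumberTheory.LFunctions.weil_criterion_holds, Bombieri2000 Thm 1–2, Weil1952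
Weil's criterion, direction positivity ⇒ RH [Weil1952; Bombieri2000 Thm 1; IwaniecKowalski2004 §5].
Expected to be discharged with the named fact weil_criterion (cite request filed) as hypothesis: (h
: weil_criterion) → this. Proof idea in print: if ρ₀ off the line, build g with ĝ concentrated at ρ₀
and 1-ρ̄₀ making the zero side of the explicit formula for g⋆g̃ negative. -/
@[route_item "route-RiemannHypothesis-WeilComb"]
def Assembly : Prop :=
  (∀ a : ℝ, 0 < a → Literature.NumberTheory.LFunctions.WeilPositivityOn a) → Summit.RiemannHypothesis

end Summit.RiemannHypothesis.RiemannHypothesis.Theses.WeilComb
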